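import Literature.NumberTheory.EllipticCurves.Kato2004.MainConjectureSkeletonProofs
import Literature.NumberTheory.EllipticCurves.Kato2004.DivisibilityInputsFine
import Literature.NumberTheory.EllipticCurves.Kato2004.EulerSystemBoundFineSelmerTwo
import Summits.BirchSwinnertonDyer.BirchSwinnertonDyer.Theorems.TwoAdicConverseLambdaHalfDefs
import HarnessLib

/-!
# Sketch — crux idea `kato-fine-defect-two` (crux `OrdLambdaHalfAtTwo`, item stmt-BirchSwinnertonDyer-19556)

BSD is NOT proved by anything here.  This file is the ideator's elaborating sketch (crux-ideate, ideator 2, GEN 4):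

* §A  pure `ℕ∞` algebra: from `a + b = c + d`, `b ≤ d`, `b ≠ ⊤` conclude `c ≤ a`;
* §B  **E-side reduction (kernel-checked)**: in the situation of Kato's §17.13 length identity
  `ℓ(X)_𝔭 + ℓ(𝐇¹/Z)_𝔭 = ℓ(Λ/(G))_𝔭 + ℓ(𝐇²)_𝔭` (tree: `Kato2004.lengthAt_add_eq_of_skeleton`), the FINE
  `λ`-half `ℓ(𝐇¹/Z)_𝔭 ≤ ℓ(𝐇²)_𝔭` (Kato Conj. 12.10, direction "⊇", no `p`-adic `L`-function) implies the
  crux's `λ`-half at `𝔭`: `ord_𝔭(G) = ℓ(Λ/(G))_𝔭 ≤ ℓ(X)_𝔭` — the mirror of the tree's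
  `Kato2004.lengthAt_eq_of_conj12_10_of_skeleton` with `≤` in place of `=`;
* §C  the same on Kato's pinned package `Kato2004.DivisibilityInputs W p f κ γ I D` (any `p`, then `p = 2`),
  and the `∀`-closure `FineLambdaHalfAtTwo W` (the transfer target `C⁺` of the card);
* §D  transport bookkeeping: termwise `≤` (Kato 13.4 (2) at `2`, tree
  `thm13_4_two_lengthAt_fineSelmerDual_le_of_isEulerSystemClassTwo`) + equality of TOTALS (the transported
  fine defect) ⇒ termwise equality (`Finset.sum_eq_sum_iff_of_le`).
-/

namespace Summit.BirchSwinnertonDyer.BirchSwinnertonDyer.Cruxes.OrdLambdaHalfAtTwo.KatoFineDefectTwo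

open Literature.NumberTheory.EllipticCurves Literature.NumberTheory.EllipticCurves.Kato2004
  Literature.NumberTheory.EllipticCurves.ModularForms

/-! ## §A  `ℕ∞` cancellation -/

/-- From `a + b = c + d`, `b ≤ d` and `b` finite: `c ≤ a`. -/
theorem le_of_add_eq_add_of_le {a b c d : ℕ∞} (h : a + b = c + d) (hbd : b ≤ d) (hb : b ≠ ⊤) :
    c ≤ a := by
  induction a using ENat.recTopCoe with
  | top => exact le_top
  | coe a =>
    lift b to ℕ using hb
    induction d using ENat.recTopCoe with
    | top =>
      exfalso
      have : ((a : ℕ∞) + (b : ℕ∞)) = ⊤ := by rw [h]; simp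
      simp at this
    | coe d =>
      induction c using ENat.recTopCoe with
      | top =>
        exfalso
        have : ((a : ℕ∞) + (b : ℕ∞)) = ⊤ := by rw [h]; simp
        simp at this
      | coe c =>
        norm_cast at h hbd ⊢
        omega

/-! ## §B  Fine `λ`-half ⟹ crux `λ`-half, in the abstract §17.13 situation -/

section Abstract

variable {R : Type*} [CommRing R]
  {H P X H2 H2loc : Type*} [AddCommGroup H] [Module R H] [AddCommGroup P]
  [Module R P] [AddCommGroup X] [Module R X] [AddCommGroup H2] [Module R H2]
  [AddCommGroup H2loc] [Module R H2loc]

/-- **Fine half at `𝔭` ⟹ `ord_𝔭 G ≤ ℓ(X)_𝔭`.**  Same binders as `Kato2004.lengthAt_add_eq_of_skeleton`;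
from its identity `ℓX + ℓ(H/Z) = ℓ(R/(G)) + ℓH2` and `ℓ(H/Z) ≤ ℓ(H2)` (finite) we get `ℓ(R/(G)) ≤ ℓX`. -/
theorem lengthAt_span_le_X_of_fineHalf (loc : H →ₗ[R] P) (hinj : Function.Injective loc)
    (toX : P →ₗ[R] X) (δ : X →ₗ[R] H2) (ε : H2 →ₗ[R] H2loc)
    (hPX : Function.Exact loc toX) (hXH : Function.Exact toX δ) (hHE : Function.Exact δ ε)
    (col : P →ₗ[R] R) (hcol : Function.Injective col) (Z : Submodule R H) {G : R}
    (𝔭 : PrimeSpectrum R) (hcoker : Module.lengthAt R (R ⧸ LinearMap.range col) 𝔭 = 0)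
    (hloc2 : Module.lengthAt R H2loc 𝔭 = 0)
    (hIG : Module.lengthAt R (R ⧸ (Z.map loc).map col) 𝔭 = Module.lengthAt R (R ⧸ Ideal.span {G}) 𝔭)
    (hfin : Module.lengthAt R (H ⧸ Z) 𝔭 ≠ ⊤)
    (hfine : Module.lengthAt R (H ⧸ Z) 𝔭 ≤ Module.lengthAt R H2 𝔭) :
    Module.lengthAt R (R ⧸ Ideal.span {G}) 𝔭 ≤ Module.lengthAt R X 𝔭 :=
  le_of_add_eq_add_of_le
    (Kato2004.lengthAt_add_eq_of_skeleton loc hinj toX δ ε hPX hXH hHE col hcol Z 𝔭 hcoker hloc2 hIG)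
    hfine hfin

end Abstract

/-! ## §C  On Kato's pinned package, and the `∀`-closure at `p = 2` -/

section Package

open scoped MatrixGroups ModularForm
open CongruenceSubgroup

variable {p : ℕ} [Fact p.Prime] {W : WeierstrassCurve ℚ} [W.IsElliptic] [W.IsGloballyMinimal]
  [ContinuousSMul ℤ_[p] (W.tateModule p)] {N : ℕ} [NeZero N] {f : CuspForm (Gamma0 N) 2}
  {κ : ZpExtension ℚ p} {γ : Field.absoluteGaloisGroup ℚ}
  {I : IwasawaH1Data W p κ γ} {D : W.SelmerDualData κ γ}

/-- **The FINE half at one height-one prime** (Kato Conj. 12.10, direction `⊇`, read on the §17.13 package):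
`ℓ_𝔭(𝐇¹_Γ(T_pW)/Z) ≤ ℓ_𝔭(𝐇²)`.  No `p`-adic `L`-function, no period, no local condition at `p`. -/
def FineHalfAt (K : DivisibilityInputs W p f κ γ I D) (𝔭 : PrimeSpectrum (IwasawaAlgebra p)) : Prop :=
  Module.lengthAt (IwasawaAlgebra p) (I.H ⧸ K.Z) 𝔭 ≤ Module.lengthAt (IwasawaAlgebra p) K.H2 𝔭

omit [NeZero N] in
/-- **Fine half at `𝔭` ⟹ `ord_𝔭(p^n L_p) ≤ ℓ_𝔭(X(E/ℚ_∞))` on the package** (the three side inputs at `𝔭`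
are the ones of `Kato2004.lengthAt_add_eq_of_skeleton`: `col` has `𝔭`-trivial cokernel, `𝐇²_loc` is
`𝔭`-trivial, and `col(loc Z)_𝔭 = (G)_𝔭`). -/
theorem lengthAt_span_G_le_X_of_fineHalfAt (K : DivisibilityInputs W p f κ γ I D)
    (𝔭 : PrimeSpectrum (IwasawaAlgebra p))
    (hcoker : Module.lengthAt (IwasawaAlgebra p) (IwasawaAlgebra p ⧸ LinearMap.range K.col) 𝔭 = 0)
    (hloc2 : Module.lengthAt (IwasawaAlgebra p) K.H2loc 𝔭 = 0)
    (hIG : Module.lengthAt (IwasawaAlgebra p) (IwasawaAlgebra p ⧸ (K.Z.map K.loc).map K.col) 𝔭 =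
      Module.lengthAt (IwasawaAlgebra p) (IwasawaAlgebra p ⧸ Ideal.span {K.G}) 𝔭)
    (hfin : Module.lengthAt (IwasawaAlgebra p) (I.H ⧸ K.Z) 𝔭 ≠ ⊤) (hfine : FineHalfAt K 𝔭) :
    Module.lengthAt (IwasawaAlgebra p) (IwasawaAlgebra p ⧸ Ideal.span {K.G}) 𝔭 ≤
      Module.lengthAt (IwasawaAlgebra p) D.X 𝔭 :=
  lengthAt_span_le_X_of_fineHalf K.loc K.loc_injective K.toX K.δ K.ε K.exact_P K.exact_X K.exact_H2
    K.col K.col_injective K.Z 𝔭 hcoker hloc2 hIG hfin hfine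

end Package

section AtTwo

open scoped MatrixGroups ModularForm
open CongruenceSubgroup

/-- **`C⁺` of the card: the FINE `λ`-half at `2` for one curve** — for the cyclotomic variable at `2`, every
newform `f` of `W`, every pinned `(𝐇¹_Γ(T₂W), X(E/ℚ_∞))` and every §17.13 package `K` on it: at every
height-one prime `𝔭 ∌ 2` of `Λ = ℤ₂⟦T⟧`, `ℓ_𝔭(𝐇¹/Z) ≤ ℓ_𝔭(𝐇²)`.  Together with the KNOWN opposite
inequality at `𝔭 ∌ 2` (Kato 13.4 (2) at `p = 2`, tree fact
`Kato2004.thm13_4_two_lengthAt_fineSelmerDual_le_of_isEulerSystemClassTwo`) this is Kato's Conj. 12.10 for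
`T₂W` at the primes where Kato states it for `p = 2`.  Nothing asserted. -/
def FineLambdaHalfAtTwo (W : WeierstrassCurve ℚ) [W.IsElliptic] [W.IsGloballyMinimal]
    [ContinuousSMul ℤ_[2] (W.tateModule 2)] : Prop :=
  ∀ (κ : ZpExtension ℚ 2) (γ : Field.absoluteGaloisGroup ℚ),
    κ.IsCyclotomic → κ.IsTopGenerator γ → IsCyclotomicVariable 2 γ →
    ∀ [NeZero (W.conductorNorm ℤ)] (f : CuspForm (Gamma0 (W.conductorNorm ℤ)) 2), IsNewformOf W f →
    ∀ (I : IwasawaH1Data W 2 κ γ) (D : W.SelmerDualData κ γ) (K : DivisibilityInputs W 2 f κ γ I D)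
      (𝔭 : PrimeSpectrum (IwasawaAlgebra 2)), 𝔭.asIdeal.height = 1 →
        PowerSeries.C (2 : ℤ_[2]) ∉ 𝔭.asIdeal → FineHalfAt K 𝔭

/-- **Per-prime form of the crux's `λ`-half that §B delivers** (what `FineLambdaHalfAtTwo` gives at each
`𝔭 ∌ 2`, granted the package side conditions): `ord_𝔭(2^n L₂(E)) ≤ ℓ_𝔭(X(E/ℚ_∞))`.  Summing over the
height-one primes `∌ 2` (with multiplicity `deg 𝔭`) is `λ(L₂(E)) ≤ λ(X(E/ℚ_∞))` = `LambdaHalfAtTwo W` up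
to the tree's `μ/λ`-bookkeeping (`Rank1Residual.X1.MuLambda.lam`); that summation is NOT done here. -/
def SpanHalfAwayFromTwo (W : WeierstrassCurve ℚ) [W.IsElliptic] [W.IsGloballyMinimal]
    [ContinuousSMul ℤ_[2] (W.tateModule 2)] : Prop :=
  ∀ (κ : ZpExtension ℚ 2) (γ : Field.absoluteGaloisGroup ℚ),
    κ.IsCyclotomic → κ.IsTopGenerator γ → IsCyclotomicVariable 2 γ →
    ∀ [NeZero (W.conductorNorm ℤ)] (f : CuspForm (Gamma0 (W.conductorNorm ℤ)) 2), IsNewformOf W f →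
    ∀ (I : IwasawaH1Data W 2 κ γ) (D : W.SelmerDualData κ γ) (K : DivisibilityInputs W 2 f κ γ I D)
      (𝔭 : PrimeSpectrum (IwasawaAlgebra 2)), 𝔭.asIdeal.height = 1 →
        PowerSeries.C (2 : ℤ_[2]) ∉ 𝔭.asIdeal →
        Module.lengthAt (IwasawaAlgebra 2) (IwasawaAlgebra 2 ⧸ LinearMap.range K.col) 𝔭 = 0 →
        Module.lengthAt (IwasawaAlgebra 2) K.H2loc 𝔭 = 0 →
        Module.lengthAt (IwasawaAlgebra 2) (IwasawaAlgebra 2 ⧸ (K.Z.map K.loc).map K.col) 𝔭 =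
          Module.lengthAt (IwasawaAlgebra 2) (IwasawaAlgebra 2 ⧸ Ideal.span {K.G}) 𝔭 →
        Module.lengthAt (IwasawaAlgebra 2) (I.H ⧸ K.Z) 𝔭 ≠ ⊤ →
          Module.lengthAt (IwasawaAlgebra 2) (IwasawaAlgebra 2 ⧸ Ideal.span {K.G}) 𝔭 ≤
            Module.lengthAt (IwasawaAlgebra 2) D.X 𝔭

/-- **FIRST LEMMA of the card (proved): `FineLambdaHalfAtTwo W → SpanHalfAwayFromTwo W`.** -/
theorem spanHalfAwayFromTwo_of_fineLambdaHalfAtTwo (W : WeierstrassCurve ℚ) [W.IsElliptic]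
    [W.IsGloballyMinimal] [ContinuousSMul ℤ_[2] (W.tateModule 2)] (h : FineLambdaHalfAtTwo W) :
    SpanHalfAwayFromTwo W := by
  intro κ γ hκ hγ hvar _ f hf I D K 𝔭 h𝔭 h2 hcoker hloc2 hIG hfin
  exact lengthAt_span_G_le_X_of_fineHalfAt K 𝔭 hcoker hloc2 hIG hfin
    (h κ γ hκ hγ hvar f hf I D K 𝔭 h𝔭 h2)

end AtTwo

/-! ## §D  Transport bookkeeping: termwise `≤` + equality of totals ⇒ termwise `=` -/

/-- If `f i ≤ g i` on `s` (Kato 13.4 (2) at `2`: `ℓ_𝔭(𝐇²) ≤ ℓ_𝔭(𝐇¹/Z)` at every `𝔭 ∌ 2`) and the totals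
satisfy `Σ g ≤ Σ f` (the transported fine defect `λ(𝐇¹/Z) − λ(𝐇²) ≤ 0`), then `f = g` termwise — i.e. the
fine half holds at EVERY `𝔭 ∌ 2`, which is what §C consumes. -/
theorem eq_on_of_le_on_of_sum_ge {ι : Type*} (s : Finset ι) (f g : ι → ℕ) (hle : ∀ i ∈ s, f i ≤ g i)
    (htot : s.sum g ≤ s.sum f) : ∀ i ∈ s, f i = g i :=
  (Finset.sum_eq_sum_iff_of_le hle).mp (le_antisymm (Finset.sum_le_sum hle) htot)

end Summit.BirchSwinnertonDyer.BirchSwinnertonDyer.Cruxes.OrdLambdaHalfAtTwo.KatoFineDefectTwo
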